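import Mathlib
import Literature.Barriers.PneNP.TSPExtensionComplexityFaces
import Literature.Barriers.PneNP.ExtendedFormulationYannakakisConverse
import Summits.ValiantsHypothesis.ValiantsHypothesis.Theorems.FifoMatchingNNDivisionHardRowFamilies
import HarnessLib

/-!
# THE EXACT LOCATED LAW *IS* COR-VIRTUAL — `ExactPencilLaw ↔ CorVirtualHardN` (crux `NNDivisionHard`,
stmt-ValiantsHypothesis-21181; route `FifoMatching`; line `virtual_passenger`)

(PART 1 of 2 of the Theorems port.)  Theorems-side port (staged by the author val-idea-41 g4; press as `Theorems/FifoMatchingNNDivisionHardExactIsVirtual.lean`,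
`--kind proof --supports stmt-ValiantsHypothesis-21181 --as helper`, AFTER the Literature part
`Literature/Barriers/PneNP/ExtendedFormulationYannakakisConverse.lean`) of the crux workfile
`Cruxes/NNDivisionHard/ExactIsVirtual41.lean` rev 2 @56f151ef35e4 (sha16 c4ea3831bf86b6be, 511 l.; farm rc 0 / 0 warnings / 0 sorries,
axioms ⊆ {propext, Classical.choice, Quot.sound}; critic of record val-idea-crit-9 g3, V#100 2026-08-29T01:27:01Z: PAPER PASS, kernel
requirements (B)(i)–(v)).  Texts verbatim by name under the namespace `Summit.ValiantsHypothesis.ValiantsHypothesis.Theorems.FifoMatching.ExactIsVirtual`;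
the frame (`T`, `CorVirtualHardN`, `RowFamily`, `RowFamily.Law`, `allRows`, `exactTilted`, `pinnedRows`, `ExactPencilLaw`, `hCOR`, `unflat`,
`exact_law_chain`) is used BY NAME from `…Theorems.FifoMatching.LocatedRows` (`Theorems/FifoMatchingNNDivisionHardRowFamilies.lean`).

The tree (`exact_law_chain`) has the chain of laws "strongest first" `pinnedRows.Law → ExactPencilLaw → allRows.Law → CorVirtualHardN`.
This file CLOSES THE CYCLE:

* `law_of_corVirtualHardN` — for every SHARP row family `F` (SHARP, hypothesis `hF` written out: for every direction `w` and every `δ > 0` the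
  family contains a positive multiple `t • w` of `w` whose right-hand side is `δ`-close to exact, `β ≤ t (h_COR(w) + δ)`),
  `CorVirtualHardN → F.Law`;
* `exactTilted_sharp`, `pinnedRows_sharp`, `allRows_sharp` — the three families of record are sharp (the pure-tilt rows
  `a = ∅`: `udRow ∅ = 0`, and the clique offset `+1` in `β` is scaled away along the pencil `(∅, w/δ)`);
* hence `exactPencilLaw_iff_corVirtualHardN : ExactPencilLaw ↔ CorVirtualHardN`, `pinnedRowsLaw_iff_corVirtualHardN`,
  `allRowsLaw_iff_corVirtualHardN`, `located_laws_equivalent` — ALL FOUR LAWS ARE ONE STATEMENT (part 2,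
  `…ExactIsVirtualGraph.lean`, adds the line's graph currency: `corVirtualHardN_iff_corVirtualHard`, `exactPencilLaw_iff_corVirtualHard` against the landed `Localization.CorVirtualHard`).

MECHANISM: Yannakakis' converse for a COMPLETE (possibly infinite) inequality family (the Literature lemma
`hasEFOfSize_of_complete_nonneg_factorization`), and sharp families are complete for every `COR(n) + Q` (`complete_of_sharp`,
via the separation lemma `mem_add_convexHull_of_forall_le`); so an `F`-blind factorisation through `r + 1` slots gives
`xc(COR(n) + Q) ≤ r + 1`, and `CorVirtualHardN` at `c + 1` with `T c n < T (c+1) n` (`n ≥ 2`) yields the law's `T c n < r`.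

CONSEQUENCES (memo `Cruxes/NNDivisionHard/ExactIsVirtual41.md`): an "enemy of C′ = `ExactPencilLaw`" is literally a counterexample to
COR-VIRTUAL; a row family is a PROPER intermediate law only if it is not sharp (no pure-tilt rows, bounded tilt-to-clique ratio);
«C′ holds on species X» ≡ «COR-VIRTUAL on X».

HONEST LABEL: REFORMULATION result; closes NO route item; `ExactPencilLaw`, `CorVirtualHardN`, `NNDivisionHard` (21181) stay OPEN —
this file proves the laws EQUIVALENT to each other and nothing about their truth; VP ≠ VNP is NOT proved here or anywhere in this tree.
-/

set_option autoImplicit false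
-- the mandated summit-side namespace repeats a component by design (single-problem summit)
set_option linter.dupNamespace false

noncomputable section

open Matrix Finset
open scoped Pointwise

namespace Summit.ValiantsHypothesis.ValiantsHypothesis.Theorems.FifoMatching.ExactIsVirtual

open Literature.Barriers.PneNP (HasEFOfSize hasEFOfSize_of_system hasEFOfSize_of_complete_nonneg_factorization)
open Literature.Combinatorics.Optimization.FixedSizePsdRank (Cube bvec flat vecOuter corPolytope)
open Summit.ValiantsHypothesis.ValiantsHypothesis.Theorems.FifoMatching.XcDivision (udInd udPt udRow udMat ud_data)
open Summit.ValiantsHypothesis.ValiantsHypothesis.Theorems.FifoMatching.LocatedRows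
  (T CorVirtualHardN RowFamily allRows exactTilted pinnedRows ExactPencilLaw hCOR le_hCOR exists_eq_hCOR flat_le_hCOR
    unflat flat_unflat exact_law_chain corVirtualHardN_of_law corVirtualHardN_of_exactPencilLaw
    corVirtualHardN_of_pinnedRowsLaw)

/-! ## §1 Exact support values in vector currency -/

section Support
variable {n : ℕ}

/-- the exact support value `h_COR(w) = max_b ⟨w, 𝟙_b𝟙_bᵀ⟩` of a (flattened) direction `w ∈ ℝ^{n²}`. -/
def hCORv (w : Fin (n * n) → ℝ) : ℝ :=
  Finset.univ.sup' Finset.univ_nonempty (fun b : Finset (Fin n) => w ⬝ᵥ udPt b)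

/-- Each vertex value is bounded by the support value `h_COR(w)`. -/
theorem le_hCORv (w : Fin (n * n) → ℝ) (b : Finset (Fin n)) : w ⬝ᵥ udPt b ≤ hCORv w :=
  Finset.le_sup' (fun b : Finset (Fin n) => w ⬝ᵥ udPt b) (Finset.mem_univ b)

/-- The support value `h_COR(w)` is attained at some vertex. -/
theorem exists_eq_hCORv (w : Fin (n * n) → ℝ) : ∃ b : Finset (Fin n), w ⬝ᵥ udPt b = hCORv w := by
  obtain ⟨b, -, hb⟩ := Finset.exists_mem_eq_sup' Finset.univ_nonempty (fun b : Finset (Fin n) => w ⬝ᵥ udPt b)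
  exact ⟨b, hb.symm⟩

/-- `hCOR W = hCORv (flat W)` (definitional). -/
theorem hCOR_eq_hCORv (W : Matrix (Fin n) (Fin n) ℝ) : hCOR W = hCORv (flat W) := rfl

/-- `hCORv w = hCOR (unflat w)`. -/
theorem hCORv_eq_hCOR_unflat (w : Fin (n * n) → ℝ) : hCORv w = hCOR (unflat w) := by
  rw [hCOR_eq_hCORv, flat_unflat]

/-- validity of the exact row `w ≤ h_COR(w)` on `COR(n)`. -/
theorem le_hCORv_of_mem (w : Fin (n * n) → ℝ) : ∀ x ∈ corPolytope n, w ⬝ᵥ x ≤ hCORv w := by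
  intro x hx
  have h := flat_le_hCOR (unflat w) x hx
  rwa [flat_unflat, ← hCORv_eq_hCOR_unflat] at h

/-- positive homogeneity (the inequality we need): `h_COR(t w) ≤ t h_COR(w)` for `t ≥ 0`. -/
theorem hCORv_smul_le {t : ℝ} (ht : 0 ≤ t) (w : Fin (n * n) → ℝ) : hCORv (t • w) ≤ t * hCORv w := by
  refine Finset.sup'_le _ _ fun b _ => ?_
  rw [smul_dotProduct, smul_eq_mul]
  exact mul_le_mul_of_nonneg_left (le_hCORv w b) ht

/-- the support value of the passenger's vertex list in direction `w`. -/
def hQv {K : ℕ} (q : Fin (K + 1) → (Fin (n * n) → ℝ)) (w : Fin (n * n) → ℝ) : ℝ :=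
  Finset.univ.sup' Finset.univ_nonempty (fun j : Fin (K + 1) => w ⬝ᵥ q j)

/-- Each generator value is bounded by the support value `h_Q(w)`. -/
theorem le_hQv {K : ℕ} (q : Fin (K + 1) → (Fin (n * n) → ℝ)) (w : Fin (n * n) → ℝ) (j : Fin (K + 1)) :
    w ⬝ᵥ q j ≤ hQv q w :=
  Finset.le_sup' (fun j : Fin (K + 1) => w ⬝ᵥ q j) (Finset.mem_univ j)

/-- The support value `h_Q(w)` is attained at some generator. -/
theorem exists_eq_hQv {K : ℕ} (q : Fin (K + 1) → (Fin (n * n) → ℝ)) (w : Fin (n * n) → ℝ) :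
    ∃ j : Fin (K + 1), w ⬝ᵥ q j = hQv q w := by
  obtain ⟨j, -, hj⟩ := Finset.exists_mem_eq_sup' Finset.univ_nonempty (fun j : Fin (K + 1) => w ⬝ᵥ q j)
  exact ⟨j, hj.symm⟩

/-- the clique vertex of a bit string: `vecOuter n (bvec a) = udPt {i | a i}`. -/
theorem vecOuter_bvec_eq_udPt (a : Cube n) :
    vecOuter n (bvec a) = udPt (Finset.univ.filter fun i => a i = true) := by
  classical
  unfold udPt udInd
  congr 1
  funext i
  simp

/-- the pure-tilt row: `udRow ∅ = 0`. -/
theorem udRow_empty : udRow (∅ : Finset (Fin n)) = 0 := by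
  funext p
  simp [udRow, udMat, udInd, flat, bvec]

/-- ★ SEPARATION: a point satisfying every exact inequality of `COR(n) + Q` lies in `COR(n) + Q` (Hahn–Banach for the
compact convex set `COR(n) + conv(q)`). -/
theorem mem_add_convexHull_of_forall_le {K : ℕ} (q : Fin (K + 1) → (Fin (n * n) → ℝ)) (x : Fin (n * n) → ℝ)
    (h : ∀ w : Fin (n * n) → ℝ, w ⬝ᵥ x ≤ hCORv w + hQv q w) :
    x ∈ corPolytope n + convexHull ℝ (Set.range q) := by
  classical
  by_contra hx
  have hCc : IsCompact (corPolytope n) := by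
    unfold corPolytope
    exact Set.Finite.isCompact_convexHull (𝕜 := ℝ) (Set.finite_range _)
  have hQc : IsCompact (convexHull ℝ (Set.range q)) :=
    Set.Finite.isCompact_convexHull (𝕜 := ℝ) (Set.finite_range _)
  have hPcl : IsClosed (corPolytope n + convexHull ℝ (Set.range q)) := (hCc.add hQc).isClosed
  have hPconv : Convex ℝ (corPolytope n + convexHull ℝ (Set.range q)) := by
    refine Convex.add ?_ (convex_convexHull ℝ _)
    unfold corPolytope
    exact convex_convexHull ℝ _
  obtain ⟨f, u, hfP, hux⟩ := geometric_hahn_banach_closed_point hPconv hPcl hx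
  -- the functional as a vector
  let w : Fin (n * n) → ℝ := fun p => f (Pi.single p 1)
  have hfw : ∀ z : Fin (n * n) → ℝ, f z = w ⬝ᵥ z := by
    intro z
    conv_lhs => rw [pi_eq_sum_univ' z]
    rw [map_sum]
    simp only [map_smul, smul_eq_mul, dotProduct, w]
    refine Finset.sum_congr rfl fun p _ => ?_
    ring
  obtain ⟨b, hb⟩ := exists_eq_hCORv w
  obtain ⟨j, hj⟩ := exists_eq_hQv q w
  have hmem : udPt b + q j ∈ corPolytope n + convexHull ℝ (Set.range q) :=
    Set.add_mem_add ((ud_data n).1 b) (subset_convexHull ℝ _ ⟨j, rfl⟩)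
  have h1 : f (udPt b + q j) < u := hfP _ hmem
  have h2 := h w
  rw [hfw, dotProduct_add, hb, hj] at h1
  rw [hfw] at hux
  linarith

end Support

/-! ## §2 (Literature) Yannakakis' converse for a complete inequality family = `Literature.Barriers.PneNP.hasEFOfSize_of_complete_nonneg_factorization` (`ExtendedFormulationYannakakisConverse.lean`), used BY NAME below. -/

/-! ## §2b Sharp row families and the EF built from a blind factorisation of `COR(n) + Q` -/

/-! ★ A row family `F` is SHARP — the hypothesis `hF` below, written out as
`∀ m w δ, 0 < δ → ∃ a t, 0 < t ∧ F.ρ m a = t • w ∧ F.β m a ≤ t * (hCORv w + δ)` (the workfile's `def Sharp`, inlined so that this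
Theorems file declares no `Prop`-valued predicate) — if, at every order, for every direction `w` and every `δ > 0` it contains a
positive multiple `t • w` of `w` with right-hand side `δ`-close to exact.  (Any family closed under scaling the tilt of an exact-rhs
pencil is sharp: the clique offset is scaled away.)  Sharp families are COMPLETE for every `COR(n) + Q` (`complete_of_sharp`). -/

section EF
variable (F : RowFamily) {n K : ℕ} {σ : Type} [Fintype σ]

/-- the vertex list of `COR(n) + Q`: `(a, j) ↦ 𝟙_a𝟙_aᵀ + q_j` over bit strings `a`. -/
def sumVert (n : ℕ) {K : ℕ} (q : Fin (K + 1) → (Fin (n * n) → ℝ)) : Cube n × Fin (K + 1) → (Fin (n * n) → ℝ) :=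
  fun p => vecOuter n (bvec p.1) + q p.2

/-- `COR(n) + conv(q) = conv(sumVert)`. -/
theorem cor_add_convexHull_eq (q : Fin (K + 1) → (Fin (n * n) → ℝ)) :
    corPolytope n + convexHull ℝ (Set.range q) = convexHull ℝ (Set.range (sumVert n q)) := by
  have hr : Set.range (sumVert n q) = Set.range (fun a : Cube n => vecOuter n (bvec a)) + Set.range q := by
    ext x
    simp only [Set.mem_range, Set.mem_add, sumVert]
    constructor
    · rintro ⟨⟨a, j⟩, rfl⟩
      exact ⟨_, ⟨a, rfl⟩, _, ⟨j, rfl⟩, rfl⟩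
    · rintro ⟨_, ⟨a, rfl⟩, _, ⟨j, rfl⟩, rfl⟩
      exact ⟨⟨a, j⟩, rfl⟩
  rw [hr, convexHull_add]
  rfl

/-- ★ sharp families are COMPLETE: a point satisfying `ρ_a·x ≤ β_a + m_a` for every row (with `m_a` attained passenger
maxima) lies in `COR(n) + Q`. -/
theorem complete_of_sharp (hF : ∀ (m : ℕ) (w : Fin (m * m) → ℝ) (δ : ℝ), 0 < δ →
      ∃ a : F.A m, ∃ t : ℝ, 0 < t ∧ F.ρ m a = t • w ∧ F.β m a ≤ t * (hCORv w + δ)) (q : Fin (K + 1) → (Fin (n * n) → ℝ))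
    (m : F.A n → ℝ) (hmax : ∀ a, ∃ j, F.ρ n a ⬝ᵥ q j = m a) (x : Fin (n * n) → ℝ)
    (hrow : ∀ a : F.A n, F.ρ n a ⬝ᵥ x ≤ F.β n a + m a) :
    x ∈ corPolytope n + convexHull ℝ (Set.range q) := by
  refine mem_add_convexHull_of_forall_le q x fun w => ?_
  refine le_of_forall_pos_le_add fun δ hδ => ?_
  obtain ⟨a, t', ht', hρ, hβ⟩ := hF n w δ hδ
  obtain ⟨j, hj⟩ := hmax a
  have h1 := hrow a
  rw [hρ, smul_dotProduct, smul_eq_mul] at h1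
  rw [hρ, smul_dotProduct, smul_eq_mul] at hj
  have h2 : w ⬝ᵥ q j ≤ hQv q w := le_hQv q w j
  have h3 : t' * (w ⬝ᵥ q j) ≤ t' * hQv q w := mul_le_mul_of_nonneg_left h2 ht'.le
  have h4 : t' * (w ⬝ᵥ x) ≤ t' * (hCORv w + hQv q w + δ) := by nlinarith
  exact le_of_mul_le_mul_left h4 ht'

/-- ★ **THE EF FROM A BLIND FACTORISATION OF A SHARP FAMILY'S SLACK.**  If the `F`-slack of `COR(n) + Q`
(`Q = conv(q)`, attained passenger maxima `m`) factors nonnegatively through slots `σ`, then `xc(COR(n) + Q) ≤ |σ|`. -/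
theorem hasEFOfSize_of_sharp_factorization (hF : ∀ (m : ℕ) (w : Fin (m * m) → ℝ) (δ : ℝ), 0 < δ →
      ∃ a : F.A m, ∃ t : ℝ, 0 < t ∧ F.ρ m a = t • w ∧ F.β m a ≤ t * (hCORv w + δ)) (q : Fin (K + 1) → (Fin (n * n) → ℝ))
    (m : F.A n → ℝ) (hmax : ∀ a, ∃ j, F.ρ n a ⬝ᵥ q j = m a)
    (U : F.A n → σ → ℝ) (V : Finset (Fin n) × Fin (K + 1) → σ → ℝ)
    (hU : ∀ a i, 0 ≤ U a i) (hV : ∀ p i, 0 ≤ V p i)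
    (hfac : ∀ a b j, (F.β n a + m a) - F.ρ n a ⬝ᵥ (udPt b + q j) = ∑ i, U a i * V (b, j) i) :
    HasEFOfSize (corPolytope n + convexHull ℝ (Set.range q)) (Fintype.card σ) := by
  classical
  rw [cor_add_convexHull_eq]
  refine hasEFOfSize_of_complete_nonneg_factorization (sumVert n q) (F.ρ n) (fun a => F.β n a + m a) ?_ U
    (fun p => V (Finset.univ.filter (fun i => p.1 i = true), p.2)) hU (fun p i => hV _ i) ?_
  · intro x hrow
    rw [← cor_add_convexHull_eq]
    exact complete_of_sharp F hF q m hmax x hrow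
  · rintro a ⟨b, j⟩
    have h := hfac a (Finset.univ.filter (fun i => b i = true)) j
    simp only [sumVert]
    rw [vecOuter_bvec_eq_udPt]
    exact h

end EF

/-! ## §3 The law of a sharp family is COR-VIRTUAL -/

/-- `T c n < T (c+1) n` once `n ≥ 2`. -/
theorem T_lt_T_succ {c n : ℕ} (hn : 2 ≤ n) : T c n < T (c + 1) n := by
  unfold T
  have hL : 1 ≤ Nat.log 2 n := Nat.log_pos (by norm_num) hn
  set L := Nat.log 2 n with hLdef
  refine Nat.pow_lt_pow_right (by norm_num) ?_
  have h1 : (L + c) ^ c ≤ (L + c + 1) ^ c := Nat.pow_le_pow_left (by omega) c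
  have h2 : 1 ≤ (L + c) ^ c := Nat.one_le_pow c (L + c) (by omega)
  have h3 : L + (c + 1) = L + c + 1 := by omega
  rw [h3, pow_succ]
  calc (L + c) ^ c < (L + c) ^ c * 2 := by omega
    _ ≤ (L + c + 1) ^ c * (L + c + 1) := Nat.mul_le_mul h1 (by omega)

/-- ★★ **THE LAW OF A SHARP ROW FAMILY FOLLOWS FROM COR-VIRTUAL.** -/
theorem law_of_corVirtualHardN (F : RowFamily) (hF : ∀ (m : ℕ) (w : Fin (m * m) → ℝ) (δ : ℝ), 0 < δ →
      ∃ a : F.A m, ∃ t : ℝ, 0 < t ∧ F.ρ m a = t • w ∧ F.β m a ≤ t * (hCORv w + δ)) (hV : CorVirtualHardN) : F.Law := by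
  classical
  intro c
  obtain ⟨n₀, hn₀⟩ := hV (c + 1)
  refine ⟨max n₀ 2, fun n hn K q r hQ m hmq hmax U V hU hV' hfac => ?_⟩
  have hn₀' : n₀ ≤ n := le_trans (le_max_left _ _) hn
  have hn2 : 2 ≤ n := le_trans (le_max_right _ _) hn
  have hEF : HasEFOfSize (corPolytope n + convexHull ℝ (Set.range q)) (r + 1) := by
    have h := hasEFOfSize_of_sharp_factorization F hF q m hmax U V hU hV' hfac
    simpa [Fintype.card_option] using h
  have h1 : T (c + 1) n < r + 1 := hn₀ n hn₀' K q (r + 1) hEF hQ.succ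
  have h2 : T c n < T (c + 1) n := T_lt_T_succ hn2
  omega

/-! ## §4 The three families of record are sharp; the four laws are one statement -/

/-- `exactTilted` is sharp: the pencil `(∅, unflat (w/δ))` (`udRow ∅ = 0`, `β = 1 + h_COR(w)/δ`). -/
theorem exactTilted_sharp :
    ∀ (m : ℕ) (w : Fin (m * m) → ℝ) (δ : ℝ), 0 < δ →
      ∃ a : exactTilted.A m, ∃ t : ℝ, 0 < t ∧ exactTilted.ρ m a = t • w ∧ exactTilted.β m a ≤ t * (hCORv w + δ) := by
  intro n w δ hδ
  refine ⟨((∅ : Finset (Fin n)), unflat ((1 / δ) • w)), 1 / δ, by positivity, ?_, ?_⟩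
  · show udRow (∅ : Finset (Fin n)) + flat (unflat ((1 / δ) • w)) = (1 / δ) • w
    rw [udRow_empty, flat_unflat, zero_add]
  · show 1 + hCOR (unflat ((1 / δ) • w)) ≤ 1 / δ * (hCORv w + δ)
    have h := hCORv_smul_le (t := 1 / δ) (by positivity) w
    rw [hCORv_eq_hCOR_unflat] at h
    have hδ' : 1 / δ * δ = 1 := by field_simp
    nlinarith

/-- `pinnedRows` is sharp: the pencil `(∅, (w/δ, argmax_b ⟨w, x_b⟩))`. -/
theorem pinnedRows_sharp :
    ∀ (m : ℕ) (w : Fin (m * m) → ℝ) (δ : ℝ), 0 < δ →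
      ∃ a : pinnedRows.A m, ∃ t : ℝ, 0 < t ∧ pinnedRows.ρ m a = t • w ∧ pinnedRows.β m a ≤ t * (hCORv w + δ) := by
  intro n w δ hδ
  obtain ⟨S, hS⟩ := exists_eq_hCORv w
  have hpin : ∀ x ∈ corPolytope n, ((1 / δ) • w) ⬝ᵥ x ≤ ((1 / δ) • w) ⬝ᵥ udPt S := by
    intro x hx
    rw [smul_dotProduct, smul_dotProduct, smul_eq_mul, smul_eq_mul, hS]
    exact mul_le_mul_of_nonneg_left (le_hCORv_of_mem w x hx) (by positivity)
  refine ⟨((∅ : Finset (Fin n)), ⟨((1 / δ) • w, S), hpin⟩), 1 / δ, by positivity, ?_, ?_⟩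
  · show udRow (∅ : Finset (Fin n)) + (1 / δ) • w = (1 / δ) • w
    rw [udRow_empty, zero_add]
  · show 1 + ((1 / δ) • w) ⬝ᵥ udPt S ≤ 1 / δ * (hCORv w + δ)
    rw [smul_dotProduct, smul_eq_mul, hS]
    have hδ' : 1 / δ * δ = 1 := by field_simp
    nlinarith

/-- `allRows` is sharp: it contains the exact row `(w, h_COR(w))` itself. -/
theorem allRows_sharp :
    ∀ (m : ℕ) (w : Fin (m * m) → ℝ) (δ : ℝ), 0 < δ →
      ∃ a : allRows.A m, ∃ t : ℝ, 0 < t ∧ allRows.ρ m a = t • w ∧ allRows.β m a ≤ t * (hCORv w + δ) := by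
  intro n w δ hδ
  refine ⟨⟨(w, hCORv w), le_hCORv_of_mem w⟩, 1, one_pos, ?_, ?_⟩
  · show w = (1 : ℝ) • w
    rw [one_smul]
  · show hCORv w ≤ 1 * (hCORv w + δ)
    linarith

/-- ★★★ **`ExactPencilLaw ↔ CorVirtualHardN`** — the law of record C′ is COR-VIRTUAL itself. -/
theorem exactPencilLaw_iff_corVirtualHardN : ExactPencilLaw ↔ CorVirtualHardN :=
  ⟨corVirtualHardN_of_exactPencilLaw, fun h => law_of_corVirtualHardN exactTilted exactTilted_sharp h⟩

/-- ★★★ `pinnedRows.Law ↔ CorVirtualHardN` — the "strongest" located law is COR-VIRTUAL too. -/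
theorem pinnedRowsLaw_iff_corVirtualHardN : pinnedRows.Law ↔ CorVirtualHardN :=
  ⟨corVirtualHardN_of_pinnedRowsLaw, fun h => law_of_corVirtualHardN pinnedRows pinnedRows_sharp h⟩

/-- ★★★ `allRows.Law ↔ CorVirtualHardN` (Yannakakis both ways). -/
theorem allRowsLaw_iff_corVirtualHardN : allRows.Law ↔ CorVirtualHardN :=
  ⟨corVirtualHardN_of_law allRows, fun h => law_of_corVirtualHardN allRows allRows_sharp h⟩

/-- ★★★ the chain `exact_law_chain` is a cycle: all four laws are equivalent. -/
theorem located_laws_equivalent :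
    (pinnedRows.Law ↔ ExactPencilLaw) ∧ (ExactPencilLaw ↔ allRows.Law) ∧ (allRows.Law ↔ CorVirtualHardN) :=
  ⟨pinnedRowsLaw_iff_corVirtualHardN.trans exactPencilLaw_iff_corVirtualHardN.symm,
    exactPencilLaw_iff_corVirtualHardN.trans allRowsLaw_iff_corVirtualHardN.symm, allRowsLaw_iff_corVirtualHardN⟩

/-- POINTWISE (species) form: at ANY order and passenger, an `exactTilted`-blind factorisation through `r + 1` slots yields
`xc(COR(n) + Q) ≤ r + 1` — «C′ decides species X» and «COR-VIRTUAL holds on X» are the same claim up to the `+1`. -/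
theorem hasEFOfSize_of_exactTilted_blind {n K r : ℕ} (q : Fin (K + 1) → (Fin (n * n) → ℝ))
    (m : exactTilted.A n → ℝ) (hmax : ∀ a, ∃ j, exactTilted.ρ n a ⬝ᵥ q j = m a)
    (U : exactTilted.A n → Option (Fin r) → ℝ) (V : Finset (Fin n) × Fin (K + 1) → Option (Fin r) → ℝ)
    (hU : ∀ a i, 0 ≤ U a i) (hV : ∀ p i, 0 ≤ V p i)
    (hfac : ∀ a b j, (exactTilted.β n a + m a) - exactTilted.ρ n a ⬝ᵥ (udPt b + q j) = ∑ i, U a i * V (b, j) i) :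
    HasEFOfSize (corPolytope n + convexHull ℝ (Set.range q)) (r + 1) := by
  have h := hasEFOfSize_of_sharp_factorization exactTilted exactTilted_sharp q m hmax U V hU hV hfac
  simpa [Fintype.card_option] using h



end Summit.ValiantsHypothesis.ValiantsHypothesis.Theorems.FifoMatching.ExactIsVirtual

end
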